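import Mathlib
import Summits.Ventures.PercRepro2.HCov
import Summits.Ventures.PercRepro2.GcTransport
import Summits.Ventures.PercRepro2.RootLeafUStarMerge

/-!
# Three-coin pinning and the pinned (outside) measure (blind cell PercRepro2, p4 g17; S3 (G4-u)
item (ad), proofs/P4-G17-COIN3.md)

`P(A) = Σ_{xyz} w_{xyz} · P(A^{xyz})` over the eight worlds `ω[f₃ ↦ z][f₂ ↦ y][f₁ ↦ x]` of three
coins (`prob_three_coins`, from `prob_eq_pin` and the preimage form of pinning), and the pinned
weights `p⁰ = p[f₃ ↦ 0][f₂ ↦ 0][f₁ ↦ 0]` as the all-closed preimage (`prob_pinned_eq`).  The mass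
table of the 3-coin class `N(b) = {a₂, u, c}` (RootLeafUCoin3TableA–D) is built on these.
-/

namespace Summit.Ventures.PercRepro2

open UnionCluster CovForm

namespace RootLeafU

/-! ## Three-coin pinning and the pinned (outside) measure -/

namespace Coin3

variable {V : Type*} {E : Type*} [Fintype E] [DecidableEq E] {R : Type*} [CommRing R]

/-- One coin, preimage form: `P(A) = p_f·P(A^{f↦1}) + (1 − p_f)·P(A^{f↦0})`. -/
lemma prob_eq_pin_preimage (p : E → R) (A : Set (Config E)) (f : E) :
    prob p A = p f * prob p {ω | Function.update ω f true ∈ A} +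
      (1 - p f) * prob p {ω | Function.update ω f false ∈ A} := by
  rw [prob_eq_pin p A f, RECM.prob_update_one_eq_preimage, RECM.prob_update_zero_eq_preimage]
  rfl

/-- **Three coins**: `P(A) = Σ_{xyz} w_{xyz} · P(A^{xyz})`, `A^{xyz} = {ω | ω[f₃ ↦ z][f₂ ↦ y][f₁ ↦ x] ∈ A}`. -/
theorem prob_three_coins (p : E → R) (A : Set (Config E)) (f₁ f₂ f₃ : E) :
    prob p A =
      p f₁ * p f₂ * p f₃ *
          prob p {ω | Function.update (Function.update (Function.update ω f₃ true) f₂ true) f₁ true ∈ A} +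
        p f₁ * p f₂ * (1 - p f₃) *
          prob p {ω | Function.update (Function.update (Function.update ω f₃ false) f₂ true) f₁ true ∈ A} +
        p f₁ * (1 - p f₂) * p f₃ *
          prob p {ω | Function.update (Function.update (Function.update ω f₃ true) f₂ false) f₁ true ∈ A} +
        p f₁ * (1 - p f₂) * (1 - p f₃) *
          prob p {ω | Function.update (Function.update (Function.update ω f₃ false) f₂ false) f₁ true ∈ A} +
        (1 - p f₁) * p f₂ * p f₃ *
          prob p {ω | Function.update (Function.update (Function.update ω f₃ true) f₂ true) f₁ false ∈ A} +
        (1 - p f₁) * p f₂ * (1 - p f₃) *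
          prob p {ω | Function.update (Function.update (Function.update ω f₃ false) f₂ true) f₁ false ∈ A} +
        (1 - p f₁) * (1 - p f₂) * p f₃ *
          prob p {ω | Function.update (Function.update (Function.update ω f₃ true) f₂ false) f₁ false ∈ A} +
        (1 - p f₁) * (1 - p f₂) * (1 - p f₃) *
          prob p {ω | Function.update (Function.update (Function.update ω f₃ false) f₂ false) f₁ false ∈ A} := by
  have h1 := prob_eq_pin_preimage p A f₁
  have h2t := prob_eq_pin_preimage p {ω | Function.update ω f₁ true ∈ A} f₂
  have h2f := prob_eq_pin_preimage p {ω | Function.update ω f₁ false ∈ A} f₂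
  simp only [Set.mem_setOf_eq] at h2t h2f
  have h3tt := prob_eq_pin_preimage p
    {ω | Function.update (Function.update ω f₂ true) f₁ true ∈ A} f₃
  have h3tf := prob_eq_pin_preimage p
    {ω | Function.update (Function.update ω f₂ false) f₁ true ∈ A} f₃
  have h3ft := prob_eq_pin_preimage p
    {ω | Function.update (Function.update ω f₂ true) f₁ false ∈ A} f₃
  have h3ff := prob_eq_pin_preimage p
    {ω | Function.update (Function.update ω f₂ false) f₁ false ∈ A} f₃
  simp only [Set.mem_setOf_eq] at h3tt h3tf h3ft h3ff
  rw [h1, h2t, h2f, h3tt, h3tf, h3ft, h3ff]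
  ring

/-- The pinned measure `p⁰ = p[f₃ ↦ 0][f₂ ↦ 0][f₁ ↦ 0]` as a preimage under the all-closed map. -/
lemma prob_pinned_eq (p : E → R) (B : Set (Config E)) (f₁ f₂ f₃ : E) :
    prob (Function.update (Function.update (Function.update p f₃ 0) f₂ 0) f₁ 0) B =
      prob p {ω | Function.update (Function.update (Function.update ω f₃ false) f₂ false) f₁ false ∈ B} := by
  rw [RECM.prob_update_zero_eq_preimage, RECM.prob_update_zero_eq_preimage,
    RECM.prob_update_zero_eq_preimage]
  rfl

end Coin3

end RootLeafU

end Summit.Ventures.PercRepro2
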